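import Summits.CriticalPhenomena.PercolationContinuityZ3.Theses.PercNearOneGluing
import Summits.CriticalPhenomena.PercolationContinuityZ3.Theorems.PercNearOneGluingAdditiveGluingK0OfCovTransfer
import Summits.CriticalPhenomena.PercolationContinuityZ3.Theorems.PercNearOneGluingAdditiveGluingK0AttachTransferD
import Summits.CriticalPhenomena.PercolationContinuityZ3.Theorems.PercNearOneGluingAdditiveGluingTOfTD
import Summits.CriticalPhenomena.PercolationContinuityZ3.Theorems.PercNearOneGluingAdditiveGluingSetGlueK0Closed
import HarnessLib

/-!
# Crux `PercNearOneGluing.AdditiveGluing` (stmt-CriticalPhenomena-4576), line `tieline`: (K₀) ⟸ Φ-transfer + aux-β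

Support file (`--supports stmt-CriticalPhenomena-4576`, helper, lead c14, Φ route).  No definitions, no named facts, no sorries.

Weighted graph on `Fin n` (`μ = prodBernoulli w`), target `b`, relays `a₁, a₂` with `a₂` the WEAKER one
(`τ_{a₂} = μ(a₂ ↔ b) ≤ μ(a₁ ↔ b) = τ_{a₁}`), observer `o`, spectator `c`.  Put `u = a₂`, `v = a₁`, `D = {u ↮ v}`,
`N = {c ↮ u} ∩ {c ↮ v}`, `NJ = N ∩ {o ↔ c}`, `m₁ = μ(D ∩ v↔b)`, `m₂ = μ(D ∩ u↔b)` and, for `x ∈ {o, c}`,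
`P_x = μ(D ∩ {v ↔ b} ∩ {x ↮ u})`, `Q_x = μ(D ∩ {u ↔ b} ∩ {v ↔ x})`, `X_x = m₂ P_x − m₁ Q_x`.

The pair kernel **(K₀)** (hypothesis `hK2` of `additiveGluing_of_k0_k0set3`, …SetGlueK0Closed.lean) reads, after the landed
identifications `M = m₁` (`K0OfCovTransfer.real_gainMax_eq`) and `M − G_x = P_x − Q_x` (`K0OfCovTransfer.real_gain_eq`),
`μ(NJ)·(P_c − Q_c) ≤ μ(N)·(P_o − Q_o)`.  This file derives it from
* (Φ) the Φ-transfer (registered stub `stub_phiTransfer_c14`, hypothesis `hPhi`): `μ(D∩NJ)·X_c ≤ μ(D∩N)·X_o`;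
* (aux-β) (registered stub `stub_auxBeta_c14`, hypothesis `hB`): `μ(D∩NJ)·P_c ≤ μ(D∩N)·P_o`;
* (γ″) the attachment transfer on `D` (`stub_k0AttachTransferD_c10`, LANDED): `μ(D∩N)·μ(NJ) ≤ μ(D∩NJ)·μ(N)`;
* the sign `X_x ≥ 0`, i.e. `m₁ Q_x ≤ m₂ P_x` (`K0OfPhiTransfer.real_sign`: two applications of the vdBHK negative correlation
  `TOfTD.negCorr` and `μ(D ∩ u↔x) + μ(D ∩ v↔x) ≤ μ(D)`);
* the τ-order on `D`, `m₂ ≤ m₁` (`K0OfCovTransfer.real_D_inter_le`), and Harris `μ(D)·μ(N) ≤ μ(D∩N)` (`TOfTD.harris_DN`) for the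
  degenerate case `μ(D ∩ N) = 0`.
Algebra (`K0OfPhiTransfer.alg`): from (Φ), (γ″), `X_o ≥ 0`: `μ(N) X_o ≥ μ(NJ) X_c`; from (aux-β), (γ″): `μ(N) P_o ≥ μ(NJ) P_c`; and
`m₁ (P_x − Q_x) = X_x + (m₁ − m₂) P_x`.
[cite: KozmaNitzan2024, Lemma 4 (p. 9), Question 7 (p. 36)] [cite: VandenbergHaggstromKahn2005, Thm. 1.5 (p. 7)]
-/

namespace Summit.CriticalPhenomena.PercolationContinuityZ3.Cruxes.AdditiveGluing.TieLine

open MeasureTheory Set Literature.Probability.LatticeModels Literature.Probability.Percolation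
open Summit.CriticalPhenomena.PercolationContinuityZ3.Theorems

noncomputable section

namespace K0OfPhiTransfer

/-! ### Real algebra -/

/-- The sign algebra: from `m₁ = r + P` (`r = μ(D ∩ vb ∩ xu)`), the two vdBHK inequalities `r·d ≤ s·m₁` (`s = μ(D ∩ ux)`),
`Q·d ≤ m₂·t` (`t = μ(D ∩ vx)`) and `s + t ≤ d`: `m₁ Q ≤ m₂ P` (divide `d·(m₂P − m₁Q) ≥ m₁m₂(d − s − t) ≥ 0` by `d`, or
`m₁ = m₂ = 0` if `d = 0`). [folklore] -/
theorem alg_sign {d m1 m2 P Q r s t : ℝ}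
    (hP : m1 = r + P) (h1 : r * d ≤ s * m1) (h2 : Q * d ≤ m2 * t) (h3 : s + t ≤ d)
    (hm1 : 0 ≤ m1) (hm2 : 0 ≤ m2) (hm1d : m1 ≤ d) (hm2d : m2 ≤ d) :
    m1 * Q ≤ m2 * P := by
  rcases (hm1.trans hm1d).eq_or_lt with h0 | hpos
  · have e1 : m1 = 0 := le_antisymm (h0 ▸ hm1d) hm1
    have e2 : m2 = 0 := le_antisymm (h0 ▸ hm2d) hm2
    rw [e1, e2]; simp
  · have a1 : m2 * (r * d) ≤ m2 * (s * m1) := mul_le_mul_of_nonneg_left h1 hm2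
    have a2 : m1 * (Q * d) ≤ m1 * (m2 * t) := mul_le_mul_of_nonneg_left h2 hm1
    have a3 : m1 * m2 * (s + t) ≤ m1 * m2 * d := mul_le_mul_of_nonneg_left h3 (mul_nonneg hm1 hm2)
    have e : d * (m2 * P) = d * m2 * m1 - m2 * (r * d) := by rw [hP]; ring
    have key : d * (m1 * Q) ≤ d * (m2 * P) := by linarith
    exact le_of_mul_le_mul_left key hpos

/-- The chain algebra: from (Φ) `DNJ·X_c ≤ DN·X_o` (`X_x = m₂P_x − m₁Q_x`), (aux-β) `DNJ·P_c ≤ DN·P_o`, (γ″) `DN·NJ ≤ DNJ·N`,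
the sign `m₁Q_o ≤ m₂P_o`, the τ-order `m₂ ≤ m₁`, Harris `d·N ≤ DN` and the trivial bounds:
`NJ·(P_c − Q_c) ≤ N·(P_o − Q_o)`, written with `M − G_x = m₁ − (m₁ − P_x + Q_x)`.  Steps: `N X_o ≥ NJ X_c`, `N P_o ≥ NJ P_c`
(cancel `DN > 0`; if `DN = 0` then `d = 0` or `N = 0` and both sides vanish), then `m₁(P_x − Q_x) = X_x + (m₁ − m₂)P_x`
(cancel `m₁ > 0`; if `m₁ = 0` all of `P, Q` vanish). [folklore] -/
theorem alg {d m1 m2 Po Pc Qo Qc N NJ DN DNJ : ℝ}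
    (hΦ : DNJ * (m2 * Pc - m1 * Qc) ≤ DN * (m2 * Po - m1 * Qo))
    (hB : DNJ * Pc ≤ DN * Po) (hγ : DN * NJ ≤ DNJ * N) (hX : m1 * Qo ≤ m2 * Po) (hτ : m2 ≤ m1)
    (hH : d * N ≤ DN) (hm1d : m1 ≤ d) (hN : 0 ≤ N) (hNJ : 0 ≤ NJ) (hNJN : NJ ≤ N) (hDN : 0 ≤ DN)
    (hPo : 0 ≤ Po) (hPc : 0 ≤ Pc) (hQo : 0 ≤ Qo) (hQc : 0 ≤ Qc)
    (hPom : Po ≤ m1) (hPcm : Pc ≤ m1) (hQom : Qo ≤ m2) (hQcm : Qc ≤ m2) :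
    NJ * (m1 - (m1 - Pc + Qc)) ≤ N * (m1 - (m1 - Po + Qo)) := by
  have hm2 : 0 ≤ m2 := hQc.trans hQcm
  have hm1 : 0 ≤ m1 := hm2.trans hτ
  have hd : 0 ≤ d := hm1.trans hm1d
  -- the case `m₁ = 0`: all of `P, Q` vanish
  have hzero : m1 = 0 → NJ * (m1 - (m1 - Pc + Qc)) ≤ N * (m1 - (m1 - Po + Qo)) := by
    intro e1
    have ePo : Po = 0 := le_antisymm (e1 ▸ hPom) hPo
    have ePc : Pc = 0 := le_antisymm (e1 ▸ hPcm) hPc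
    have eQo : Qo = 0 := le_antisymm (hQom.trans (e1 ▸ hτ)) hQo
    have eQc : Qc = 0 := le_antisymm (hQcm.trans (e1 ▸ hτ)) hQc
    rw [ePo, ePc, eQo, eQc]; simp
  rcases hDN.eq_or_lt with hDN0 | hDNpos
  · -- `μ(D ∩ N) = 0`: then `d·N = 0`, so `d = 0` (hence `m₁ = 0`) or `N = 0` (hence `NJ = 0`)
    have hdN : d * N = 0 := le_antisymm (hDN0 ▸ hH) (mul_nonneg hd hN)
    rcases mul_eq_zero.1 hdN with hd0 | hN0
    · exact hzero (le_antisymm (hd0 ▸ hm1d) hm1)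
    · have eNJ : NJ = 0 := le_antisymm (hN0 ▸ hNJN) hNJ
      rw [hN0, eNJ]; simp
  · -- (5) `N·X_o ≥ NJ·X_c`
    have h5 : NJ * (m2 * Pc - m1 * Qc) ≤ N * (m2 * Po - m1 * Qo) := by
      by_cases hXc : 0 ≤ m2 * Pc - m1 * Qc
      · have a1 : N * (DNJ * (m2 * Pc - m1 * Qc)) ≤ N * (DN * (m2 * Po - m1 * Qo)) :=
          mul_le_mul_of_nonneg_left hΦ hN
        have a2 : (m2 * Pc - m1 * Qc) * (DN * NJ) ≤ (m2 * Pc - m1 * Qc) * (DNJ * N) :=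
          mul_le_mul_of_nonneg_left hγ hXc
        have key : DN * (NJ * (m2 * Pc - m1 * Qc)) ≤ DN * (N * (m2 * Po - m1 * Qo)) := by linarith
        exact le_of_mul_le_mul_left key hDNpos
      · have a1 : NJ * (m2 * Pc - m1 * Qc) ≤ 0 := mul_nonpos_of_nonneg_of_nonpos hNJ (not_le.1 hXc).le
        have a2 : 0 ≤ N * (m2 * Po - m1 * Qo) := mul_nonneg hN (sub_nonneg.2 hX)
        linarith
    -- (6) `N·P_o ≥ NJ·P_c`
    have h6 : NJ * Pc ≤ N * Po := by
      have a1 : N * (DNJ * Pc) ≤ N * (DN * Po) := mul_le_mul_of_nonneg_left hB hN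
      have a2 : Pc * (DN * NJ) ≤ Pc * (DNJ * N) := mul_le_mul_of_nonneg_left hγ hPc
      have key : DN * (NJ * Pc) ≤ DN * (N * Po) := by linarith
      exact le_of_mul_le_mul_left key hDNpos
    -- (7) `m₁(P_x − Q_x) = X_x + (m₁ − m₂)P_x`
    rcases hm1.eq_or_lt with hm10 | hm1pos
    · exact hzero hm10.symm
    · have a3 : (m1 - m2) * (NJ * Pc) ≤ (m1 - m2) * (N * Po) := mul_le_mul_of_nonneg_left h6 (sub_nonneg.2 hτ)
      have key : m1 * (NJ * (m1 - (m1 - Pc + Qc))) ≤ m1 * (N * (m1 - (m1 - Po + Qo))) := by linarith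
      exact le_of_mul_le_mul_left key hm1pos

variable {n : ℕ}

/-! ### The sign `X_x ≥ 0` -/

/-- `D ∩ {u ↔ x}` and `D ∩ {v ↔ x}` are disjoint (`u ↔ x ↔ v` would join `u` to `v`). [folklore] -/
theorem disjoint_D_inter (u v x : Fin n) :
    Disjoint ((openConn u v)ᶜ ∩ openConn u x : Set (BondConfig (Fin n))) ((openConn u v)ᶜ ∩ openConn v x) := by
  rw [Set.disjoint_left]
  intro ω h1 h2
  simp only [mem_inter_iff, mem_compl_iff, openConn, mem_setOf_eq] at h1 h2
  exact h1.1 (h1.2.trans h2.2.symm)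

/-- `μ(D ∩ u↔x) + μ(D ∩ v↔x) ≤ μ(D)` (disjoint subsets of `D = {u ↮ v}`). [folklore] -/
theorem real_add_le_D (w : Sym2 (Fin n) → unitInterval) (u v x : Fin n) :
    (prodBernoulli w).real ((openConn u v)ᶜ ∩ openConn u x : Set (BondConfig (Fin n))) +
        (prodBernoulli w).real ((openConn u v)ᶜ ∩ openConn v x : Set (BondConfig (Fin n))) ≤
      (prodBernoulli w).real ((openConn u v)ᶜ : Set (BondConfig (Fin n))) := by
  rw [← measureReal_union (disjoint_D_inter u v x) MeasurableSet.of_discrete]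
  exact measureReal_mono (union_subset inter_subset_left inter_subset_left)

/-- **The sign `X_x ≥ 0`**: `μ(D ∩ v↔b)·μ(D ∩ u↔b ∩ v↔x) ≤ μ(D ∩ u↔b)·μ(D ∩ v↔b ∩ x↮u)` (`D = {u ↮ v}`).
Proof: `P_x = m₁ − μ(D ∩ vb ∩ xu)`; vdBHK Thm. 1.5 twice (`TOfTD.negCorr`): `μ(D ∩ vb ∩ xu)·μ(D) ≤ μ(D ∩ ux)·m₁` and
`Q_x·μ(D) ≤ m₂·μ(D ∩ vx)`; and `μ(D ∩ ux) + μ(D ∩ vx) ≤ μ(D)`; so `μ(D)·(m₂P_x − m₁Q_x) ≥ m₁m₂(μ(D) − μ(D∩ux) − μ(D∩vx)) ≥ 0`.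
If `u = v` then `D = ∅`. [cite: VandenbergHaggstromKahn2005, Thm. 1.5 (p. 7)] -/
theorem real_sign (w : Sym2 (Fin n) → unitInterval) (b u v x : Fin n) :
    (prodBernoulli w).real ((openConn u v)ᶜ ∩ openConn v b : Set (BondConfig (Fin n))) *
        (prodBernoulli w).real ((openConn u v)ᶜ ∩ openConn u b ∩ openConn v x : Set (BondConfig (Fin n))) ≤
      (prodBernoulli w).real ((openConn u v)ᶜ ∩ openConn u b : Set (BondConfig (Fin n))) *
        (prodBernoulli w).real ((openConn u v)ᶜ ∩ openConn v b ∩ (openConn x u)ᶜ : Set (BondConfig (Fin n))) := by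
  by_cases huv : u = v
  · subst huv
    simp only [SpectatorEdgeBHK.compl_openConn_self, empty_inter, measureReal_empty, zero_mul, le_refl]
  have hP := ML5EdgeIdentity.real_eq_inter_add_inter_compl w
    ((openConn u v)ᶜ ∩ openConn v b : Set (BondConfig (Fin n))) (openConn x u)
  have h1 := TOfTD.negCorr w x u v b huv
  rw [show ((openConn u v)ᶜ ∩ (openConn u x ∩ openConn v b) : Set (BondConfig (Fin n))) =
      (openConn u v)ᶜ ∩ openConn v b ∩ openConn x u from by
        rw [inter_assoc, inter_comm (openConn v b), KNPreFKG.openConn_symm x u]] at h1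
  have h2 := TOfTD.negCorr w b u v x huv
  rw [← inter_assoc] at h2
  exact alg_sign hP h1 h2 (real_add_le_D w u v x) measureReal_nonneg measureReal_nonneg
    (measureReal_mono inter_subset_left) (measureReal_mono inter_subset_left)

end K0OfPhiTransfer

open K0OfCovTransfer K0OfPhiTransfer in
/-- **(K₀) ⟸ Φ-transfer (Φ) + aux-β + (γ″)** [+ sign + τ-order]: the two registered stubs `stub_phiTransfer_c14` (hypothesis
`hPhi`, `μ(D∩NJ)·X_c ≤ μ(D∩N)·X_o`) and `stub_auxBeta_c14` (hypothesis `hB`, `μ(D∩NJ)·P_c ≤ μ(D∩N)·P_o`) imply the pair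
slack-inheritance kernel (K₀) = the hypothesis `hK2` of `additiveGluing_of_k0_k0set3`, so that the crux follows from
`stub_phiTransfer_c14`, `stub_auxBeta_c14` and `stub_k0set3_g2`.  With `u = a₂` (weaker), `v = a₁`: (γ″) =
`stub_k0AttachTransferD_c10`, `X_o ≥ 0` (`real_sign`), `m₂ ≤ m₁` (`real_D_inter_le`), Harris (`TOfTD.harris_DN`), then
`M − G_x = P_x − Q_x` (`real_gainMax_eq`, `real_gain_eq`) and `K0OfPhiTransfer.alg`.
[cite: KozmaNitzan2024, Lemma 4 (p. 9), Question 7 (p. 36)] [cite: VandenbergHaggstromKahn2005, Thm. 1.5 (p. 7)] -/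
theorem k0_of_phiTransfer
    (hPhi : ∀ (n : ℕ) (w : Sym2 (Fin n) → unitInterval) (o b u v c : Fin n), (Literature.Probability.LatticeModels.prodBernoulli w).real ((Literature.Probability.Percolation.openConn u v)ᶜ ∩ ((Literature.Probability.Percolation.openConn c u)ᶜ ∩ (Literature.Probability.Percolation.openConn c v)ᶜ) ∩ Literature.Probability.Percolation.openConn o c : Set (Literature.Probability.Percolation.BondConfig (Fin n))) * ((Literature.Probability.LatticeModels.prodBernoulli w).real ((Literature.Probability.Percolation.openConn u v)ᶜ ∩ Literature.Probability.Percolation.openConn u b : Set (Literature.Probability.Percolation.BondConfig (Fin n))) * (Literature.Probability.LatticeModels.prodBernoulli w).real ((Literature.Probability.Percolation.openConn u v)ᶜ ∩ Literature.Probability.Percolation.openConn v b ∩ (Literature.Probability.Percolation.openConn c u)ᶜ : Set (Literature.Probability.Percolation.BondConfig (Fin n))) - (Literature.Probability.LatticeModels.prodBernoulli w).real ((Literature.Probability.Percolation.openConn u v)ᶜ ∩ Literature.Probability.Percolation.openConn v b : Set (Literature.Probability.Percolation.BondConfig (Fin n))) * (Literature.Probability.LatticeModels.prodBernoulli w).real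 ((Literature.Probability.Percolation.openConn u v)ᶜ ∩ Literature.Probability.Percolation.openConn u b ∩ Literature.Probability.Percolation.openConn v c : Set (Literature.Probability.Percolation.BondConfig (Fin n)))) ≤ (Literature.Probability.LatticeModels.prodBernoulli w).real ((Literature.Probability.Percolation.openConn u v)ᶜ ∩ ((Literature.Probability.Percolation.openConn c u)ᶜ ∩ (Literature.Probability.Percolation.openConn c v)ᶜ) : Set (Literature.Probability.Percolation.BondConfig (Fin n))) * ((Literature.Probability.LatticeModels.prodBernoulli w).real ((Literature.Probability.Percolation.openConn u v)ᶜ ∩ Literature.Probability.Percolation.openConn u b : Set (Literature.Probability.Percolation.BondConfig (Fin n))) * (Literature.Probability.LatticeModels.prodBernoulli w).real ((Literature.Probability.Percolation.openConn u v)ᶜ ∩ Literature.Probability.Percolation.openConn v b ∩ (Literature.Probability.Percolation.openConn o u)ᶜ : Set (Literature.Probability.Percolation.BondConfig (Fin n))) - (Literature.Probability.LatticeModels.prodBernoulli w).real ((Literature.Probability.Percolation.openConn u v)ᶜ ∩ Literature.Probability.Percolation.openConn v b : Set (Literature.Probability.Percolation.BondConfig (Fin n))) * (Literature.Probability.LatticeModels.prodBernoulli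 w).real ((Literature.Probability.Percolation.openConn u v)ᶜ ∩ Literature.Probability.Percolation.openConn u b ∩ Literature.Probability.Percolation.openConn v o : Set (Literature.Probability.Percolation.BondConfig (Fin n)))))
    (hB : ∀ (n : ℕ) (w : Sym2 (Fin n) → unitInterval) (o b u v c : Fin n), (Literature.Probability.LatticeModels.prodBernoulli w).real ((Literature.Probability.Percolation.openConn u v)ᶜ ∩ ((Literature.Probability.Percolation.openConn c u)ᶜ ∩ (Literature.Probability.Percolation.openConn c v)ᶜ) ∩ Literature.Probability.Percolation.openConn o c : Set (Literature.Probability.Percolation.BondConfig (Fin n))) * (Literature.Probability.LatticeModels.prodBernoulli w).real ((Literature.Probability.Percolation.openConn u v)ᶜ ∩ Literature.Probability.Percolation.openConn v b ∩ (Literature.Probability.Percolation.openConn c u)ᶜ : Set (Literature.Probability.Percolation.BondConfig (Fin n))) ≤ (Literature.Probability.LatticeModels.prodBernoulli w).real ((Literature.Probability.Percolation.openConn u v)ᶜ ∩ ((Literature.Probability.Percolation.openConn c u)ᶜ ∩ (Literature.Probability.Percolation.openConn c v)ᶜ) : Set (Literature.Probability.Percolation.BondConfig (Fin n))) * (Literature.Probability.LatticeModels.prodBernoulli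 w).real ((Literature.Probability.Percolation.openConn u v)ᶜ ∩ Literature.Probability.Percolation.openConn v b ∩ (Literature.Probability.Percolation.openConn o u)ᶜ : Set (Literature.Probability.Percolation.BondConfig (Fin n)))) :
    ∀ (n : ℕ) (w : Sym2 (Fin n) → unitInterval) (o b a₁ a₂ c : Fin n), (Literature.Probability.LatticeModels.prodBernoulli w).real (Literature.Probability.Percolation.openConn a₂ b) ≤ (Literature.Probability.LatticeModels.prodBernoulli w).real (Literature.Probability.Percolation.openConn a₁ b) → (Literature.Probability.LatticeModels.prodBernoulli w).real ((Literature.Probability.Percolation.openConn c a₁)ᶜ ∩ (Literature.Probability.Percolation.openConn c a₂)ᶜ ∩ Literature.Probability.Percolation.openConn o c) * ((Literature.Probability.LatticeModels.prodBernoulli w).real (Literature.Probability.Percolation.openConn a₁ b ∪ Literature.Probability.Percolation.openConn a₂ b) - (Literature.Probability.LatticeModels.prodBernoulli w).real (Literature.Probability.Percolation.openConn a₂ b) - (Literature.Probability.LatticeModels.prodBernoulli w).real ((Literature.Probability.Percolation.openConn c b)ᶜ ∩ (Literature.Probability.Percolation.openConn c a₁ ∪ Literature.Probability.Percolation.openConn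 c a₂) ∩ (Literature.Probability.Percolation.openConn a₁ b ∪ Literature.Probability.Percolation.openConn a₂ b))) ≤ (Literature.Probability.LatticeModels.prodBernoulli w).real ((Literature.Probability.Percolation.openConn c a₁)ᶜ ∩ (Literature.Probability.Percolation.openConn c a₂)ᶜ : Set (Literature.Probability.Percolation.BondConfig (Fin n))) * ((Literature.Probability.LatticeModels.prodBernoulli w).real (Literature.Probability.Percolation.openConn a₁ b ∪ Literature.Probability.Percolation.openConn a₂ b) - (Literature.Probability.LatticeModels.prodBernoulli w).real (Literature.Probability.Percolation.openConn a₂ b) - (Literature.Probability.LatticeModels.prodBernoulli w).real ((Literature.Probability.Percolation.openConn o b)ᶜ ∩ (Literature.Probability.Percolation.openConn o a₁ ∪ Literature.Probability.Percolation.openConn o a₂) ∩ (Literature.Probability.Percolation.openConn a₁ b ∪ Literature.Probability.Percolation.openConn a₂ b))) := by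
  intro n w o b a₁ a₂ c hτ
  have hΦ := hPhi n w o b a₂ a₁ c
  have hβ := hB n w o b a₂ a₁ c
  have hγ := stub_k0AttachTransferD_c10 n w o a₂ a₁ c
  have hH := TOfTD.harris_DN w a₂ a₁ c
  have hNs : ((openConn c a₂)ᶜ ∩ (openConn c a₁)ᶜ : Set (BondConfig (Fin n))) = (openConn c a₁)ᶜ ∩ (openConn c a₂)ᶜ :=
    Set.inter_comm _ _
  rw [hNs] at hΦ hβ hγ hH
  rw [real_gainMax_eq w b a₁ a₂, real_gain_eq w o b a₁ a₂, real_gain_eq w c b a₁ a₂]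
  exact alg hΦ hβ hγ (real_sign w b a₂ a₁ o) (real_D_inter_le w b a₁ a₂ hτ) hH
    (measureReal_mono inter_subset_left) measureReal_nonneg measureReal_nonneg (measureReal_mono inter_subset_left)
    measureReal_nonneg measureReal_nonneg measureReal_nonneg measureReal_nonneg measureReal_nonneg
    (measureReal_mono inter_subset_left) (measureReal_mono inter_subset_left)
    (measureReal_mono inter_subset_left) (measureReal_mono inter_subset_left)

/-- Plug check: `k0_of_phiTransfer` slots into the official skeleton in place of `k0_of_covTransfer …` — the crux from
`stub_phiTransfer_c14`, `stub_auxBeta_c14` (hypotheses `hPhi`, `hB`) and `stub_k0set3_g2` (hypothesis `hK3`). -/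
example
    (hPhi : ∀ (n : ℕ) (w : Sym2 (Fin n) → unitInterval) (o b u v c : Fin n), (Literature.Probability.LatticeModels.prodBernoulli w).real ((Literature.Probability.Percolation.openConn u v)ᶜ ∩ ((Literature.Probability.Percolation.openConn c u)ᶜ ∩ (Literature.Probability.Percolation.openConn c v)ᶜ) ∩ Literature.Probability.Percolation.openConn o c : Set (Literature.Probability.Percolation.BondConfig (Fin n))) * ((Literature.Probability.LatticeModels.prodBernoulli w).real ((Literature.Probability.Percolation.openConn u v)ᶜ ∩ Literature.Probability.Percolation.openConn u b : Set (Literature.Probability.Percolation.BondConfig (Fin n))) * (Literature.Probability.LatticeModels.prodBernoulli w).real ((Literature.Probability.Percolation.openConn u v)ᶜ ∩ Literature.Probability.Percolation.openConn v b ∩ (Literature.Probability.Percolation.openConn c u)ᶜ : Set (Literature.Probability.Percolation.BondConfig (Fin n))) - (Literature.Probability.LatticeModels.prodBernoulli w).real ((Literature.Probability.Percolation.openConn u v)ᶜ ∩ Literature.Probability.Percolation.openConn v b : Set (Literature.Probability.Percolation.BondConfig (Fin n))) * (Literature.Probability.LatticeModels.prodBernoulli w).real ((Literature.Probability.Percolation.openConn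 u v)ᶜ ∩ Literature.Probability.Percolation.openConn u b ∩ Literature.Probability.Percolation.openConn v c : Set (Literature.Probability.Percolation.BondConfig (Fin n)))) ≤ (Literature.Probability.LatticeModels.prodBernoulli w).real ((Literature.Probability.Percolation.openConn u v)ᶜ ∩ ((Literature.Probability.Percolation.openConn c u)ᶜ ∩ (Literature.Probability.Percolation.openConn c v)ᶜ) : Set (Literature.Probability.Percolation.BondConfig (Fin n))) * ((Literature.Probability.LatticeModels.prodBernoulli w).real ((Literature.Probability.Percolation.openConn u v)ᶜ ∩ Literature.Probability.Percolation.openConn u b : Set (Literature.Probability.Percolation.BondConfig (Fin n))) * (Literature.Probability.LatticeModels.prodBernoulli w).real ((Literature.Probability.Percolation.openConn u v)ᶜ ∩ Literature.Probability.Percolation.openConn v b ∩ (Literature.Probability.Percolation.openConn o u)ᶜ : Set (Literature.Probability.Percolation.BondConfig (Fin n))) - (Literature.Probability.LatticeModels.prodBernoulli w).real ((Literature.Probability.Percolation.openConn u v)ᶜ ∩ Literature.Probability.Percolation.openConn v b : Set (Literature.Probability.Percolation.BondConfig (Fin n))) * (Literature.Probability.LatticeModels.prodBernoulli w).real ((Literature.Probability.Percolation.openConn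 u v)ᶜ ∩ Literature.Probability.Percolation.openConn u b ∩ Literature.Probability.Percolation.openConn v o : Set (Literature.Probability.Percolation.BondConfig (Fin n)))))
    (hB : ∀ (n : ℕ) (w : Sym2 (Fin n) → unitInterval) (o b u v c : Fin n), (Literature.Probability.LatticeModels.prodBernoulli w).real ((Literature.Probability.Percolation.openConn u v)ᶜ ∩ ((Literature.Probability.Percolation.openConn c u)ᶜ ∩ (Literature.Probability.Percolation.openConn c v)ᶜ) ∩ Literature.Probability.Percolation.openConn o c : Set (Literature.Probability.Percolation.BondConfig (Fin n))) * (Literature.Probability.LatticeModels.prodBernoulli w).real ((Literature.Probability.Percolation.openConn u v)ᶜ ∩ Literature.Probability.Percolation.openConn v b ∩ (Literature.Probability.Percolation.openConn c u)ᶜ : Set (Literature.Probability.Percolation.BondConfig (Fin n))) ≤ (Literature.Probability.LatticeModels.prodBernoulli w).real ((Literature.Probability.Percolation.openConn u v)ᶜ ∩ ((Literature.Probability.Percolation.openConn c u)ᶜ ∩ (Literature.Probability.Percolation.openConn c v)ᶜ) : Set (Literature.Probability.Percolation.BondConfig (Fin n))) * (Literature.Probability.LatticeModels.prodBernoulli w).real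 ((Literature.Probability.Percolation.openConn u v)ᶜ ∩ Literature.Probability.Percolation.openConn v b ∩ (Literature.Probability.Percolation.openConn o u)ᶜ : Set (Literature.Probability.Percolation.BondConfig (Fin n))))
    (hK3 : ∀ (n : ℕ) (w : Sym2 (Fin n) → unitInterval) (S : Finset (Fin n)) (o b c s₀ : Fin n), 3 ≤ S.card → s₀ ∈ S → c ∉ S → (∀ s ∈ S, (prodBernoulli w).real (openConn s₀ b) ≤ (prodBernoulli w).real (openConn s b)) → (prodBernoulli w).real ((⋃ s ∈ S, (openConn c s : Set (BondConfig (Fin n))))ᶜ ∩ openConn o c) * ((prodBernoulli w).real (⋃ s ∈ S, (openConn s b : Set (BondConfig (Fin n)))) - (prodBernoulli w).real (openConn s₀ b) - (prodBernoulli w).real ((openConn c b)ᶜ ∩ (⋃ s ∈ S, (openConn c s : Set (BondConfig (Fin n)))) ∩ (⋃ s ∈ S, (openConn s b : Set (BondConfig (Fin n)))))) ≤ (prodBernoulli w).real ((⋃ s ∈ S, (openConn c s : Set (BondConfig (Fin n))))ᶜ) * ((prodBernoulli w).real (⋃ s ∈ S, (openConn s b : Set (BondConfig (Fin n)))) - (prodBernoulli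 w).real (openConn s₀ b) - (prodBernoulli w).real ((openConn o b)ᶜ ∩ (⋃ s ∈ S, (openConn o s : Set (BondConfig (Fin n)))) ∩ (⋃ s ∈ S, (openConn s b : Set (BondConfig (Fin n))))))) :
    Summit.CriticalPhenomena.PercolationContinuityZ3.Theses.PercNearOneGluing.AdditiveGluing :=
  Summit.CriticalPhenomena.PercolationContinuityZ3.Theorems.additiveGluing_of_k0_k0set3 (k0_of_phiTransfer hPhi hB) hK3

end

end Summit.CriticalPhenomena.PercolationContinuityZ3.Cruxes.AdditiveGluing.TieLine
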